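import Mathlib
import HarnessLib
/-!
# Viscous Hou–Luo profile MODEL: the far-field stagnation identity that pins the `κ → ∞` exponent to `c_l = 3`

HONEST FRAMING (cell ns-blowup GROUP B «PROFILE SEARCH», zone Z3-b′; human rulings D-0035/D-0074): **1-D MODEL (the Hou–Luo
boundary model with Laplacian dissipation added by the cell), pen-and-paper algebra kernel-checked; not Boussinesq, not Euler,
not Navier–Stokes; «violates: none — MODEL».** Nothing in this file is a statement about Navier–Stokes.

OBJECT. The frozen-`ε` profile system of the viscous Hou–Luo model in the gauge `c_ω = 1` (STATUS pre-registration of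
profile-eng-3 g2; = the profile system `HouLuoProfileEqAt` of `Literature/Analysis/FluidPDE/HouLuoModelSelfSimilarBlowup.lean`
[cite: HuangQinWangWei2025HouLuo, eq. (2.1)] at their `c_ω = −1`, plus dissipation):
  `F₁ ≡ Ω + c_l ξ Ω′ + 𝒰 Ω′ − P − ε Ω″ = 0`,  `F₂ ≡ (2 + HΩ) P + c_l ξ P′ + 𝒰 P′ − ε P″ = 0`,  `𝒰′ = HΩ`, `𝒰(0) = 0`,
`Ω` and `P = Θ′` odd. The cell's sinc engine (profile-eng-5 g3, kit jobs j253106/j253077/j253247/j253314) finds ONE smooth family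
of solutions through the Chen–Hou–Huang inviscid profile [cite: ChenHouHuang2022HouLuo, Thm. 1.1]: in the unit-slope gauge
`Ω′(0) = 1` it is parametrised by `ε̃ ∈ [0, ∞)` (equivalently, at `ε = 1`, by `κ = Ω′(0) = √ε̃`), with `c_l(0) = 2.9987041982`,
a minimum `c_l = 2.74020` at `ε̃ ≈ 0.93`, and `c_l → 3` as `ε̃ → ∞` (`|c_l − 3| ≤ 6·10⁻⁷` for `ε̃ ≥ 750`); the family never reaches
the constant-viscosity value `c_l = 1/2`.

THE MECHANISM KERNEL-CHECKED HERE (the algebraic core of «`c_l → 3`»). For `ε̃ > 0.28` the rescaled velocity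
`V = c_l ξ + 𝒰` has an interior zero `ξ_*` (a stagnation point) that recedes, as `ε̃ → ∞`, into the region where the profile IS
its power-law far field `Ω = A ξ^{−p}`, `p = 1/c_l` (measured: `ξ_* = 2.3, 166, 2 991, 44 187` at `ε̃ = 1, 10², 10³, 8·10³`;
`ε̃/ξ_*² → 4·10⁻⁶`, so transport there is inviscid). In that region `HΩ = −A k ξ^{−p}` for a constant `k` (classically
`k = cot(πp/2)`; its value is IRRELEVANT below) and `𝒰 = B ξ^{1−p}` with `B(1 − p) = −A k` (so that `𝒰′ = HΩ`,
`hasDerivAt_farU`). Smooth passage of the (inviscid) transport equations through `V(ξ_*) = 0` requires `2 + HΩ(ξ_*) = 0`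
(from `F₂`: `(2 + HΩ)P = −V P′` with `P(ξ_*) > 0`) and `P(ξ_*) = Ω(ξ_*)` (from `F₁`). THIS FILE PROVES: at any zero of
`V` inside the power-law field, **`HΩ(ξ_*) = −(c_l − 1)` identically in `A, k`** (`stagnation_hilbert`) and
**`P(ξ_*) = Ω(ξ_*)` automatically** for the far-field form `P = 𝒰 Ω′` (`stagnation_P`, `farField_F1`); hence the
smooth-passage condition forces **`c_l = 3`** (`exponent_eq_three`). MEASURED (hl3.json, j253314): `HΩ(ξ_*) + 2 =
+4.1·10⁻³, +1.2·10⁻⁴, +4.6·10⁻⁶` and `P(ξ_*)/Ω(ξ_*) = 0.99837, 0.99995, 0.999998` at `ε̃ = 10², 10³, 8·10³`.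
WHAT IS NOT PROVED HERE (and is not claimed): that the numerical family exists, that `ξ_*` enters the power-law region, the
Hilbert-transform asymptotics `HΩ ∼ −A cot(πp/2) ξ^{−p}` for `Ω ∼ A·sgn ξ·|ξ|^{−p}` [folklore: Riesz-potential identity; the
constant is not used], or anything about the inviscid Chen–Hou–Huang / Huang–Qin–Wang–Wei profile itself. Only real algebra and
one-variable calculus of power functions on `(0, ∞)`; no `def … : Prop` hypotheses.
PLACEMENT: cell-own MODEL lemma under `Summits/NavierStokesRegularity/OSWSelfSimilar/` next to `SheetRowThirdExactFamily`
(profile-eng-5 g2); bears on LADDER-NS N5 / zone Z3-b′ → N1 linear core (SELFSIM-NOGO M8 «Chen–Hou + viscosity» on the 1-D MODEL).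
-/

namespace Summit.NavierStokesRegularity.OSWSelfSimilar
namespace HouLuoFarFieldStagnation

/-- Far-field vorticity profile `Ω(ξ) = A ξ^{−p}` (`p = 1/c_l`), `ξ > 0`. [folklore: the `ξ → ∞` balance of `Ω + c_l ξ Ω′`;
cf. [cite: HuangQinWangWei2025HouLuo, Thm. 1.1] «`lim x^{1/c_l} Ω(x)` exists and is positive»] -/
noncomputable def farOm (A p ξ : ℝ) : ℝ := A * ξ ^ (-p)

/-- Its derivative `Ω′(ξ) = −p A ξ^{−p−1}`. [folklore] -/
noncomputable def farDOm (A p ξ : ℝ) : ℝ := -(p * A) * ξ ^ (-p - 1)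

/-- Far-field Hilbert transform `HΩ(ξ) = −A k ξ^{−p}` (classically `k = cot(πp/2)` for `0 < p < 1`; the value of `k` is not
used anywhere in this file). [folklore] -/
noncomputable def farHOm (A k p ξ : ℝ) : ℝ := -(A * k) * ξ ^ (-p)

/-- Far-field rescaled velocity potential `𝒰(ξ) = B ξ^{1−p}`; `𝒰′ = HΩ` forces `B (1 − p) = −A k` (`hasDerivAt_farU`). [folklore] -/
noncomputable def farU (B p ξ : ℝ) : ℝ := B * ξ ^ (1 - p)

/-- `ξ^{1−p} = ξ · ξ^{−p}` for `ξ > 0`. [folklore] -/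
theorem rpow_one_sub (p : ℝ) {ξ : ℝ} (hξ : 0 < ξ) : ξ ^ (1 - p) = ξ * ξ ^ (-p) := by
  rw [show (1 : ℝ) - p = 1 + -p by ring, Real.rpow_add hξ, Real.rpow_one]

/-- `ξ · ξ^{−p−1} = ξ^{−p}` for `ξ > 0`. [folklore] -/
theorem mul_rpow_neg_sub_one (p : ℝ) {ξ : ℝ} (hξ : 0 < ξ) : ξ * ξ ^ (-p - 1) = ξ ^ (-p) := by
  rw [show -p - 1 = -p + (-1 : ℝ) by ring, Real.rpow_add hξ, Real.rpow_neg_one]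
  field_simp

/-- `ξ^{1−p} · ξ^{−p−1} = ξ^{−p} · ξ^{−p}` for `ξ > 0`. [folklore] -/
theorem rpow_one_sub_mul_rpow_neg_sub_one (p : ℝ) {ξ : ℝ} (hξ : 0 < ξ) :
    ξ ^ (1 - p) * ξ ^ (-p - 1) = ξ ^ (-p) * ξ ^ (-p) := by
  rw [← Real.rpow_add hξ, ← Real.rpow_add hξ]
  ring_nf

/-- CALCULUS CHECK `Ω′`: `farOm A p` has derivative `farDOm A p ξ` at `ξ > 0`. [folklore] -/
theorem hasDerivAt_farOm (A p : ℝ) {ξ : ℝ} (hξ : 0 < ξ) : HasDerivAt (farOm A p) (farDOm A p ξ) ξ := by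
  have h : HasDerivAt (fun y : ℝ => A * y ^ (-p)) (A * (-p * ξ ^ (-p - 1))) ξ :=
    (Real.hasDerivAt_rpow_const (p := -p) (Or.inl hξ.ne')).const_mul A
  unfold farOm farDOm
  exact h.congr_deriv (by ring)

/-- CALCULUS CHECK `𝒰′ = HΩ`: if `B (1 − p) = −A k` then `farU B p` has derivative `farHOm A k p ξ` at `ξ > 0`. [folklore] -/
theorem hasDerivAt_farU (A k B p : ℝ) (hB : B * (1 - p) = -(A * k)) {ξ : ℝ} (hξ : 0 < ξ) :
    HasDerivAt (farU B p) (farHOm A k p ξ) ξ := by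
  have h : HasDerivAt (fun y : ℝ => B * y ^ (1 - p)) (B * ((1 - p) * ξ ^ (1 - p - 1))) ξ :=
    (Real.hasDerivAt_rpow_const (p := 1 - p) (Or.inl hξ.ne')).const_mul B
  rw [show (1 : ℝ) - p - 1 = -p by ring] at h
  unfold farU farHOm
  exact h.congr_deriv (by rw [← hB]; ring)

/-- THE FAR FIELD SOLVES THE INVISCID `F₁` WITH `P = 𝒰 Ω′` EXACTLY WHEN `p c_l = 1`: for `ξ > 0`,
`Ω + c_l ξ Ω′ + 𝒰 Ω′ − 𝒰 Ω′ = (1 − c_l p) Ω`. [folklore: leading-order balance] -/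
theorem farField_F1 (A B c p : ℝ) {ξ : ℝ} (hξ : 0 < ξ) :
    farOm A p ξ + c * ξ * farDOm A p ξ + farU B p ξ * farDOm A p ξ - farU B p ξ * farDOm A p ξ
      = (1 - c * p) * farOm A p ξ := by
  unfold farOm farDOm
  have h := mul_rpow_neg_sub_one p hξ
  calc A * ξ ^ (-p) + c * ξ * (-(p * A) * ξ ^ (-p - 1)) + farU B p ξ * (-(p * A) * ξ ^ (-p - 1))
        - farU B p ξ * (-(p * A) * ξ ^ (-p - 1))
        = A * ξ ^ (-p) - c * (p * A) * (ξ * ξ ^ (-p - 1)) := by ring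
    _ = (1 - c * p) * (A * ξ ^ (-p)) := by rw [h]; ring

/-- **STAGNATION IDENTITY FOR THE HILBERT TRANSFORM.** In the power-law far field, at any zero `ξ_* > 0` of the rescaled
velocity `V = c_l ξ + 𝒰(ξ)`, one has `HΩ(ξ_*) = −(c_l − 1)` — identically in the amplitude `A` and the Hilbert constant `k`,
given only `𝒰′ = HΩ` (`B(1−p) = −Ak`) and `p c_l = 1`. [new here — MODEL] -/
theorem stagnation_hilbert (A k B c p : ℝ) (hB : B * (1 - p) = -(A * k)) (hcp : c * p = 1) {ξ : ℝ} (hξ : 0 < ξ)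
    (hstag : c * ξ + farU B p ξ = 0) : farHOm A k p ξ = -(c - 1) := by
  have hy : ξ ^ (1 - p) = ξ * ξ ^ (-p) := rpow_one_sub p hξ
  unfold farU at hstag
  rw [hy] at hstag
  -- `ξ (c + B ξ^{−p}) = 0` with `ξ > 0`
  have h1 : c + B * ξ ^ (-p) = 0 := by
    have h2 : ξ * (c + B * ξ ^ (-p)) = 0 := by linear_combination hstag
    rcases mul_eq_zero.mp h2 with h | h
    · exact absurd h hξ.ne'
    · exact h
  unfold farHOm
  linear_combination (-(ξ ^ (-p))) * hB + (1 - p) * h1 + hcp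

/-- **STAGNATION IDENTITY FOR `P`.** With the far-field form `P = 𝒰 Ω′`, at a zero `ξ_* > 0` of `V = c_l ξ + 𝒰`:
`P(ξ_*) = Ω(ξ_*)` automatically (so the `F₁`-regularity condition at the stagnation point is void). [new here — MODEL] -/
theorem stagnation_P (A B c p : ℝ) (hcp : c * p = 1) {ξ : ℝ} (hξ : 0 < ξ) (hstag : c * ξ + farU B p ξ = 0) :
    farU B p ξ * farDOm A p ξ = farOm A p ξ := by
  have hy : ξ ^ (1 - p) = ξ * ξ ^ (-p) := rpow_one_sub p hξ
  have hprod : ξ ^ (1 - p) * ξ ^ (-p - 1) = ξ ^ (-p) * ξ ^ (-p) := rpow_one_sub_mul_rpow_neg_sub_one p hξ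
  have h1 : c + B * ξ ^ (-p) = 0 := by
    unfold farU at hstag
    rw [hy] at hstag
    have h2 : ξ * (c + B * ξ ^ (-p)) = 0 := by linear_combination hstag
    rcases mul_eq_zero.mp h2 with h | h
    · exact absurd h hξ.ne'
    · exact h
  unfold farU farDOm farOm
  calc B * ξ ^ (1 - p) * (-(p * A) * ξ ^ (-p - 1)) = -(p * A * B) * (ξ ^ (1 - p) * ξ ^ (-p - 1)) := by ring
    _ = -(p * A * B) * (ξ ^ (-p) * ξ ^ (-p)) := by rw [hprod]
    _ = A * ξ ^ (-p) := by linear_combination (-(p * A * ξ ^ (-p))) * h1 + (A * ξ ^ (-p)) * hcp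

/-- **THE `κ → ∞` EXPONENT.** If, at a stagnation point lying in the power-law far field, the smooth-passage condition
`2 + HΩ(ξ_*) = 0` of the `P`-transport equation holds, then `c_l = 3`. (The cell's measured family has
`HΩ(ξ_*) + 2 = 4.6·10⁻⁶` and `c_l − 3 = −1.5·10⁻⁷` at `ε̃ = 8 000`.) [new here — MODEL] -/
theorem exponent_eq_three (A k B c p : ℝ) (hB : B * (1 - p) = -(A * k)) (hcp : c * p = 1) {ξ : ℝ} (hξ : 0 < ξ)
    (hstag : c * ξ + farU B p ξ = 0) (hpass : 2 + farHOm A k p ξ = 0) : c = 3 := by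
  have h := stagnation_hilbert A k B c p hB hcp hξ hstag
  linarith

/-- Converse bookkeeping: with `c_l = 3` (so `p = 1/3`) the smooth-passage condition `2 + HΩ(ξ_*) = 0` HOLDS at every
far-field stagnation point — the limit is self-consistent. [new here — MODEL] -/
theorem passage_of_three (A k B p : ℝ) (hB : B * (1 - p) = -(A * k)) (hp : 3 * p = 1) {ξ : ℝ} (hξ : 0 < ξ)
    (hstag : 3 * ξ + farU B p ξ = 0) : 2 + farHOm A k p ξ = 0 := by
  have h := stagnation_hilbert A k B 3 p hB hp hξ hstag
  linarith

end HouLuoFarFieldStagnation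
end Summit.NavierStokesRegularity.OSWSelfSimilar
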